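import Summits.BirchSwinnertonDyer.BirchSwinnertonDyer.Theorems.SchneiderFreeAdditiveX3GordTwoBranchIMCDivOfKY
import Summits.BirchSwinnertonDyer.BirchSwinnertonDyer.Theorems.SchneiderFreeAdditiveX3GoodMemberStub
import Literature.NumberTheory.EllipticCurves.IsogenyLocalPointsMaps
import Literature.NumberTheory.EllipticCurves.HeegnerPointsOfConductor
import HarnessLib
import HarnessLib.Audit.Tags

/-!
# Route `SchneiderFreeAdditiveX3` (K1 door), crux `GordTwoBranchIMC` (stmt-BirchSwinnertonDyer-19177):
# SHORT NAMES for the inputs of the line «KY-read» (skeleton v5) — the record vocabulary the planner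
# asked for (HOME memos/ROUTE-P2-upper-v1-g13.md §8, U26): `KYReadGoodMember`, `KYReadCH`, `KYReadSliver`

Cell `bsd-schneider-ideate` (HOME `run/shared/lean/pub/bsd-schneider-ideate/`), seat `door-c3` gen 8.
PARTITION: board row B6 ∩ X3 ∩ sst-twist, r = 1, (G-ord, `e = 2`) half (2 560 of 7 101 pairs) of
`Rank1Residual.partition`; types-the-object-of the H-record of crux r3 (one-line signature in the
route file's vocabulary, see below; proved in the sibling `…GordTwoBranchIMCOfKYRead.lean`); closes
nothing (BSD is not advanced; the crux stays OPEN).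

Statements only — three predicates WITH BODIES and one bookkeeping theorem; nothing is asserted about
elliptic curves. Each body is VERBATIM a binder of door-c3 gen 7's assembly
`gordTwoBranchIMC_of_facts_of_KY_OPEN` (p473966, `…GordTwoBranchIMCOfKY.lean`) = the corresponding
registered stub of skeleton v5 «KY-read» (P2 g13, sha bcbd83ef):

* `KYReadGoodMember` — the good-member input `hGM` = `stub_goodMember`; NO LONGER OPEN: door-c4 gen 7
  proved it from `nonempty_modularParametrizationData` alone
  (`GoodMember.stub_goodMember_of_modularParametrization`, p481411), recorded here as
  `kyReadGoodMember_of_modularParametrization`;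
* `KYReadCH` — the Castella–Hsieh input `hCH` = `stub_CH`: at every presented socket datum of the
  cell with `d_K ≠ −3`, every conjugate degree-one prime `𝔭′ ≠ 𝔭` and every embedding datum `ι′`
  inducing `𝔭′`, a frame `IsBDPLFunction ι′ 𝔭′ κ γ Dt.f Ω_K Ω_p L` of the branch AT `𝔭′` with `μ = 0`
  (`¬ p ∣ L`) and the conductor-`p` value formula with the logarithm at `𝔭′` — PUBLISHED for the
  frame's construction and value (Castella–Hsieh, Math. Ann. 370 (2018) §3, Thm. 5.7, Lemma 5.4, on
  the `χ_ε`-branch of `f̃ = f_{W′}`) up to the translation `f̃ ⊗ ε ↔ f` (a derivation) and Keller–Yin's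
  `μ(𝓛_ε) = 0` (PREPRINT) — UNTYPED in the tree (typer wants wi-73259/73260);
* `KYReadSliver` — the old bundled input on the `d_K = −3` sockets only (`stub_sliver`; outside
  Keller–Yin's Assumption 2.0.3; void at `p = 3`; OFF the leaf path by door-c5 gen 8's p478396).

The three cite-only published facts of the road outside `PrintedFacts` (Gross 2004 §2 ∧ CM-rationality
of the conductor-`p` Heegner point ∧ Cai–Shu–Tian 2014 Thm. 1.1 = `stub_rebasedFactsG`) are NOT
bundled here: they are Literature `def`s consumed BY NAME (the planner files the fact-bundle route item
`RebasedFactsG`). With these names the H-record of crux r3 reads, in the route file's vocabulary,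
`PrintedFacts → ControlFacts → RebasedFactsG → thm351_…_OPEN → KYReadCH → KYReadSliver →
GordTwoBranchIMC` (proof: `gordTwoBranchIMC_of_KYRead` of the sibling `…GordTwoBranchIMCOfKYRead.lean`),
and the rung leaf on the (G-ord, `e = 2`) half needs `KYReadCH` but NOT `KYReadSliver`
(`additiveX3RankOneLower_of_KYRead`, ibid.).

HONEST FRAMING: Keller–Yin arXiv:2410.23241 Thm. 3.5.1 stays the typed PREPRINT claim
`KellerYin2024.thm351_imc_isTorsion_mu_zero_charIdeal_eq_OPEN` (never restated here); `KYReadCH` and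
`KYReadSliver` are hypotheses of the road, not facts of the tree, and all three predicates are tagged
`@[conjecture]` (obligation nodes: predicates, nothing asserted — `KYReadGoodMember` is the one already
provable by name) exactly like the route's sockets; BSD is not advanced. Theses-free
(imports only Theorems defs / Literature), so the route file may import this module for the H-record.

References: Keller–Yin arXiv:2410.23241 Thm. 3.5.1, §3.3 ¶1, Rem. 3.5.2, Assumption 2.0.3;
Castella–Hsieh, Math. Ann. 370 (2018) §3, Thm. 5.7, Lemma 5.4 (arXiv:1505.08165 pp. 10–11, 17–19);
Gross 2004 §2; Gross 1991 §3; Darmon 2004 Thm. 3.6; Cai–Shu–Tian, ANT 8 (2014) Thm. 1.1;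
Milne ADT I.4.10; Kolyvagin 1990; Gross–Zagier 1986 I.(6.3); BCDT 2001.
-/

noncomputable section

open scoped Classical ComplexConjugate

open WeierstrassCurve NumberField IsDedekindDomain Field PowerSeries
  Literature.NumberTheory.EllipticCurves
  Literature.NumberTheory.EllipticCurves.ModularForms
  Literature.NumberTheory.EllipticCurves.GreenbergSelmer
  Literature.NumberTheory.EllipticCurves.Rank1Residual
  Literature.NumberTheory.EllipticCurves.KellerYin2024
  Literature.NumberTheory.GaloisRepresentations
  Summit.BirchSwinnertonDyer.Rank1Residual
  Summit.BirchSwinnertonDyer.Rank1Residual.X11b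
  Summit.BirchSwinnertonDyer.Rank1Residual.X11b.AcSelmer
  Summit.BirchSwinnertonDyer.Rank1Residual.X11b.Halves

-- D-0017 layout: summit = sub-problem, so `Summit.BirchSwinnertonDyer.BirchSwinnertonDyer.…` is the
-- mandated namespace (same option as the route's sockets files).
set_option linter.dupNamespace false
set_option autoImplicit false

namespace Summit.BirchSwinnertonDyer.BirchSwinnertonDyer.Theorems.SchneiderFree.KYRead

/-! ## §1 The good member (no longer open) -/

/-- **`KYReadGoodMember`** — Keller–Yin's per-class lattice normalisation as an input (§3.3 ¶1 /
Rem. 3.5.2: "replacing `T` by a different Galois stable lattice if necessary"): in the `ℚ`-isogeny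
class of every curve of the (G-ord, `e = 2`) reducible cell, over every imaginary quadratic `K` with
`p` split, a member `W₁ →_φ W` (degree `p^m·d`, `p ∤ d`, same conductor) in Case (I), `Red`, with a
rational `p`-line non-trivial on the decomposition groups at `p` and `W₁(K)[p] = 0`. VERBATIM the
binder `hGM` of p473966 = the registered stub `stub_goodMember`. NOT open any more: a THEOREM from
`nonempty_modularParametrizationData` (door-c4 gen 7, `kyReadGoodMember_of_modularParametrization`
below). [cite: KellerYin2024b, §3.3 ¶1 and Rem. 3.5.2 (arXiv:2410.23241 pp. 14, 20)] -/
@[conjecture]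
def KYReadGoodMember : Prop :=
  ∀ (W : WeierstrassCurve ℚ) [W.IsElliptic] [W.IsGloballyMinimal] (p : ℕ) [Fact p.Prime],
    p ≠ 2 → ClassX3 W p → Additive.SubGordTwo W p →
    ∀ (K : Type) [Field K] [NumberField K], IsImaginaryQuadratic K →
    ((Ideal.span {(p : ℤ)}).primesOver (𝓞 K)).ncard = 2 →
    ∃ (W₁ : WeierstrassCurve ℚ) (_ : W₁.IsElliptic) (_ : W₁.IsGloballyMinimal)
      (φ : WeierstrassCurve.Isogeny W₁ W) (m d : ℕ),
      φ.degree = p ^ m * d ∧ ¬ p ∣ d ∧ W₁.conductorNorm ℤ = W.conductorNorm ℤ ∧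
      W₁.HasGoodOrdinaryReductionOverQuadraticAt p ∧ Red W₁ p ∧
      (∃ Φ : AddSubgroup (geomTorsion W₁ (p : ℤ)),
        IsRationalLine W₁ p Φ ∧ ¬ LineDecompositionTrivialAt W₁ p Φ) ∧
      ∀ Q : (W₁.baseChange K).toAffine.Point, p • Q = 0 → Q = 0

/-- **The good member is a THEOREM granted modularity** (door-c4 gen 7,
`GoodMember.stub_goodMember_of_modularParametrization`, p481411: K-W by two maximal-cyclic quotient
steps and one inertia element, `W₁(K)[p] = 0` by odd quadratic descent, `N_{W₁} = N_W` by strong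
multiplicity one): `nonempty_modularParametrizationData → KYReadGoodMember`. Bookkeeping alias so that
the record vocabulary is complete; nothing new is proved here.
[cite: KellerYin2024b, §3.3 ¶1 and Rem. 3.5.2] [cite: AtkinLehner1970, Thm. 4] -/
theorem kyReadGoodMember_of_modularParametrization (hPar : nonempty_modularParametrizationData) :
    KYReadGoodMember :=
  fun W _ _ p _ hp2 hX hS K _ _ hK hsplit ↦
    GoodMember.stub_goodMember_of_modularParametrization hPar W p hp2 hX hS K hK hsplit

/-! ## §2 The two inputs still open on the crux: Castella–Hsieh at the conjugate prime, and the `d_K = −3` sliver -/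

/-- **`KYReadCH`** — the Castella–Hsieh input of the KY-read road (`hCH` of p473966 = registered
`stub_CH`, VERBATIM). For the presented door curve `W = C₂ • ((D • W′) ⊗ χ_{p*})` (`W′` good ordinary
at `p`) at every socket datum with `d_K ≠ −3`, every conjugate degree-one prime `𝔭′ ≠ 𝔭` above `p`
and every embedding datum `ι′` inducing `𝔭′`: CM periods `Ω_K ≠ 0`, `Ω_p ≠ 0`, a frame `L ∈ R₀⟦T⟧`
with `IsBDPLFunction ι′ 𝔭′ κ γ Dt.f Ω_K Ω_p L` (the branch AT `𝔭′`), `¬ p ∣ L` (`μ = 0`), and the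
conductor-`p` VALUE FORMULA `L(𝟙) = u·(log_{ω_W}(Q)/c′)²`, `u ∈ R₀`, at the descent `Q ∈ W(K)` of the
genus-twisted conductor-`p` Heegner point of `W′` over `K[p]`, the logarithm through `embAt K p 𝔭′`.
In print: Castella–Hsieh's construction and `p`-adic Gross–Zagier formula for `(f̃ = f_{W′}, χ_ε)`
read as a frame of `f = f̃ ⊗ ε` (a derivation: `L(f/K, ξ, 1) = L(f̃/K, χ_ε ξ, 1)`, multiplier
`ε(½,·)^{-2}` absorbed into `Ω_p`), and `μ(𝓛_ε) = 0` (Keller–Yin Thm. 3.5.1, PREPRINT). A predicate;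
nothing asserted; UNTYPED input (typer wants wi-73259/73260).
[cite: CastellaHsieh2018, §3 Def. 3.7 / Prop. 3.8, Thm. 5.7 and Lemma 5.4 (arXiv:1505.08165 pp. 10–11, 17–19)]
[cite: KellerYin2024b, §3.4 and Thm. 3.5.1 (arXiv:2410.23241 pp. 19–20) (preprint)] -/
@[conjecture]
def KYReadCH : Prop :=
  ∀ (p : ℕ) [Fact p.Prime] (W' : WeierstrassCurve ℚ) [W'.IsElliptic] [W'.IsGloballyMinimal]
    [NeZero (W'.conductorNorm ℤ)] (D C₂ : VariableChange ℚ) [(D • W').IsCharNeTwoNF]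
    [(C₂ • (D • W').quadraticTwist ((-1 : ℚ) ^ (p / 2) * p)).IsElliptic]
    [(C₂ • (D • W').quadraticTwist ((-1 : ℚ) ^ (p / 2) * p)).IsGloballyMinimal]
    (N : ℕ) [NeZero N] (K : Type) [Field K] [NumberField K]
    (Dt : ModularParametrizationData (C₂ • (D • W').quadraticTwist ((-1 : ℚ) ^ (p / 2) * p)) N)
    (H : HeegnerDatum N (NumberField.discr K)) (ι : K →+* ℂ)
    (P : ((C₂ • (D • W').quadraticTwist ((-1 : ℚ) ^ (p / 2) * p)).baseChange K).toAffine.Point),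
    (C₂ • (D • W').quadraticTwist ((-1 : ℚ) ^ (p / 2) * p)).analyticRank = 1 →
    Additive.N10.Locus (C₂ • (D • W').quadraticTwist ((-1 : ℚ) ^ (p / 2) * p)) p →
    (C₂ • (D • W').quadraticTwist ((-1 : ℚ) ^ (p / 2) * p)).conductorNorm ℤ = N →
    IsImaginaryQuadratic K → Odd (NumberField.discr K) → ¬ p ∣ Units.torsionOrder K →
    SatisfiesHeegnerHypothesis N K →
    ((C₂ • (D • W').quadraticTwist ((-1 : ℚ) ^ (p / 2) * p)).quadraticTwist
      (NumberField.discr K : ℚ)).entireLFunction 1 ≠ 0 →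
    WeierstrassCurve.Affine.Point.map ι.toRatAlgHom P = heegnerPointComplex Dt H →
    ¬ IsOfFinAddOrder P → p ≠ 2 → GoodOrd W' p → NumberField.discr K ≠ -3 →
    ∀ (κ : ZpExtension K p), κ.IsAnticyclotomic →
    ∀ (γ : Field.absoluteGaloisGroup K) [Fact (κ.IsTopGenerator γ)]
      (𝔭 : HeightOneSpectrum (𝓞 K)) (h𝔭 : ((p : ℕ) : 𝓞 K) ∈ 𝔭.asIdeal)
      (he : 𝔭.asIdeal.ramificationIdx (𝓞 ℚ) = 1) (hf : 𝔭.asIdeal.inertiaDeg (𝓞 ℚ) = 1),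
    ∀ [NumberField (ringClassField K ι p)]
      (Dt' : ModularParametrizationData W' (W'.conductorNorm ℤ)),
    ∀ (𝔭' : HeightOneSpectrum (𝓞 K)) (h𝔭' : ((p : ℕ) : 𝓞 K) ∈ 𝔭'.asIdeal)
      (he' : 𝔭'.asIdeal.ramificationIdx (𝓞 ℚ) = 1) (hf' : 𝔭'.asIdeal.inertiaDeg (𝓞 ℚ) = 1),
    𝔭 ≠ 𝔭' → ∀ (ι' : PadicAlgCl p ≃+* ℂ), BranchInducesPrime p ι' 𝔭' →
    ∃ (ΩK : ℂ) (Ωp : ℂ_[p]) (L : UnrSeries p) (u : unrIntegers p),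
      ΩK ≠ 0 ∧ Ωp ≠ 0 ∧ IsBDPLFunction ι' 𝔭' κ γ Dt.f ΩK Ωp L ∧ ¬ C (p : unrIntegers p) ∣ L ∧
      ∀ (y : (W'.baseChange (ringClassField K ι p : Type)).toAffine.Point),
        WeierstrassCurve.Affine.Point.map (ringClassField K ι p).subtype.toRatAlgHom y =
          heegnerPointComplexOfConductor Dt' (NumberField.discr K) H.β p →
        ∀ (θ : ringClassField K ι p)
          (hθ2 : θ ^ 2 = algebraMap ℚ (ringClassField K ι p) ((-1 : ℚ) ^ (p / 2) * p))
          (hθ : θ ≠ 0) (s : ringClassGal ι p → ℤˣ),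
        (∀ σ : ringClassGal ι p, σ.1 θ = ((s σ : ℤ) : ringClassField K ι p) * θ) →
        ∀ Q : ((C₂ • (D • W').quadraticTwist ((-1 : ℚ) ^ (p / 2) * p)).baseChange K).toAffine.Point,
        Affine.Point.map (algebraMap K (ringClassField K ι p)).toRatAlgHom Q =
          VariableChange.pointEquivBaseChange ((D • W').quadraticTwist ((-1 : ℚ) ^ (p / 2) * p)) C₂
            (ringClassField K ι p)
            ((VariableChange.pointEquiv (((D • W').quadraticTwist
                ((-1 : ℚ) ^ (p / 2) * p)).baseChange (ringClassField K ι p : Type))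
                (untwistAt hθ)).symm
              ((Affine.Point.congrEquiv (untwistAt_smul_eq (D • W') hθ2 hθ)).symm
                (VariableChange.pointEquivBaseChange W' D (ringClassField K ι p)
                  (∑ τ : ringClassGal ι p,
                    (s τ : ℤ) • pointGalHom W' (ringClassField K ι p : Type) τ.1 y)))) →
        L.HasValueAt 0 (((u : unrIntegers p) : ℂ_[p]) *
          (algebraMap ℚ_[p] ℂ_[p] (logOmega (C₂ • (D • W').quadraticTwist ((-1 : ℚ) ^ (p / 2) * p))
            p (embAt K p 𝔭' h𝔭' he' hf') Q / (Dt'.c : ℚ_[p]))) ^ 2)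

/-- **`KYReadSliver`** — the old bundled frame input `hKYCH` of door-c3 gen 6 (KY divisibility ∧
CH value, at `𝔭` itself) RESTRICTED to the sockets with `d_K = −3` (`hSliver` of p473966 =
registered `stub_sliver`, VERBATIM): outside Keller–Yin's standing Assumption 2.0.3 ("`D_K < −3`");
void at `p = 3` (`p ∤ #𝓞_K^× = 6`, door-c3 gen 7 `sliver_void_at_three`); off the leaf path (door-c5
gen 8, `additiveX3RankOneLower_of_facts_of_KY_OPEN`); the crux as typed quantifies over every Heegner
field, so it remains an input of the crux record. A predicate; nothing asserted.
[cite: KellerYin2024b, Assumption 2.0.3 (arXiv:2410.23241 p. 8)] [cite: CastellaHsieh2018, Thm. 5.7] -/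
@[conjecture]
def KYReadSliver : Prop :=
  ∀ (p : ℕ) [Fact p.Prime] (W' : WeierstrassCurve ℚ) [W'.IsElliptic] [W'.IsGloballyMinimal]
    [NeZero (W'.conductorNorm ℤ)] (D C₂ : VariableChange ℚ) [(D • W').IsCharNeTwoNF]
    [(C₂ • (D • W').quadraticTwist ((-1 : ℚ) ^ (p / 2) * p)).IsElliptic]
    [(C₂ • (D • W').quadraticTwist ((-1 : ℚ) ^ (p / 2) * p)).IsGloballyMinimal]
    (N : ℕ) [NeZero N] (K : Type) [Field K] [NumberField K]
    (Dt : ModularParametrizationData (C₂ • (D • W').quadraticTwist ((-1 : ℚ) ^ (p / 2) * p)) N)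
    (H : HeegnerDatum N (NumberField.discr K)) (ι : K →+* ℂ)
    (P : ((C₂ • (D • W').quadraticTwist ((-1 : ℚ) ^ (p / 2) * p)).baseChange K).toAffine.Point),
    (C₂ • (D • W').quadraticTwist ((-1 : ℚ) ^ (p / 2) * p)).analyticRank = 1 →
    Additive.N10.Locus (C₂ • (D • W').quadraticTwist ((-1 : ℚ) ^ (p / 2) * p)) p →
    (C₂ • (D • W').quadraticTwist ((-1 : ℚ) ^ (p / 2) * p)).conductorNorm ℤ = N →
    IsImaginaryQuadratic K → Odd (NumberField.discr K) → ¬ p ∣ Units.torsionOrder K →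
    SatisfiesHeegnerHypothesis N K →
    ((C₂ • (D • W').quadraticTwist ((-1 : ℚ) ^ (p / 2) * p)).quadraticTwist
      (NumberField.discr K : ℚ)).entireLFunction 1 ≠ 0 →
    WeierstrassCurve.Affine.Point.map ι.toRatAlgHom P = heegnerPointComplex Dt H →
    ¬ IsOfFinAddOrder P → p ≠ 2 → GoodOrd W' p → NumberField.discr K = -3 →
    ∀ (κ : ZpExtension K p), κ.IsAnticyclotomic →
    ∀ (γ : Field.absoluteGaloisGroup K) [Fact (κ.IsTopGenerator γ)]
      (𝔭 : HeightOneSpectrum (𝓞 K)) (h𝔭 : ((p : ℕ) : 𝓞 K) ∈ 𝔭.asIdeal)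
      (he : 𝔭.asIdeal.ramificationIdx (𝓞 ℚ) = 1) (hf : 𝔭.asIdeal.inertiaDeg (𝓞 ℚ) = 1),
    ∀ [NumberField (ringClassField K ι p)]
      (Dt' : ModularParametrizationData W' (W'.conductorNorm ℤ)),
    ∃ (L : UnrSeries p) (u : unrIntegers p),
      (XAc.charIdeal ((C₂ • (D • W').quadraticTwist ((-1 : ℚ) ^ (p / 2) * p)).baseChange K)
          p κ 𝔭 ∅ γ).map (PowerSeries.map (toUnr p)) ≤ Ideal.span {L} ∧
      ∀ (y : (W'.baseChange (ringClassField K ι p : Type)).toAffine.Point),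
        WeierstrassCurve.Affine.Point.map (ringClassField K ι p).subtype.toRatAlgHom y =
          heegnerPointComplexOfConductor Dt' (NumberField.discr K) H.β p →
        ∀ (θ : ringClassField K ι p)
          (hθ2 : θ ^ 2 = algebraMap ℚ (ringClassField K ι p) ((-1 : ℚ) ^ (p / 2) * p))
          (hθ : θ ≠ 0) (s : ringClassGal ι p → ℤˣ),
        (∀ σ : ringClassGal ι p, σ.1 θ = ((s σ : ℤ) : ringClassField K ι p) * θ) →
        ∀ Q : ((C₂ • (D • W').quadraticTwist ((-1 : ℚ) ^ (p / 2) * p)).baseChange K).toAffine.Point,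
        Affine.Point.map (algebraMap K (ringClassField K ι p)).toRatAlgHom Q =
          VariableChange.pointEquivBaseChange ((D • W').quadraticTwist ((-1 : ℚ) ^ (p / 2) * p)) C₂
            (ringClassField K ι p)
            ((VariableChange.pointEquiv (((D • W').quadraticTwist
                ((-1 : ℚ) ^ (p / 2) * p)).baseChange (ringClassField K ι p : Type))
                (untwistAt hθ)).symm
              ((Affine.Point.congrEquiv (untwistAt_smul_eq (D • W') hθ2 hθ)).symm
                (VariableChange.pointEquivBaseChange W' D (ringClassField K ι p)
                  (∑ τ : ringClassGal ι p,
                    (s τ : ℤ) • pointGalHom W' (ringClassField K ι p : Type) τ.1 y)))) →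
        L.HasValueAt 0 (((u : unrIntegers p) : ℂ_[p]) *
          (algebraMap ℚ_[p] ℂ_[p] (logOmega (C₂ • (D • W').quadraticTwist ((-1 : ℚ) ^ (p / 2) * p))
            p (embAt K p 𝔭 h𝔭 he hf) Q / (Dt'.c : ℚ_[p]))) ^ 2)

end Summit.BirchSwinnertonDyer.BirchSwinnertonDyer.Theorems.SchneiderFree.KYRead

end
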